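import Summits.Ventures.CertifiedQuantumChemistry.Certificates.HubbardRingL4LiftFeasible
import Summits.Ventures.CertifiedQuantumChemistry.Rows.HubbardRingStrongCouplingLimit
import HarnessLib

/-!
# Ventures/CertifiedQuantumChemistry — Certificates/HubbardRingL4LiftPlateauFloor.lean: the KERNEL-GRADE PLATEAU FLOOR of
# the half-filled Hubbard 4-ring — `OPT_DQG(hubbardRingTV 4 1 U; 2, 2) ≤ (−8 − 4√2 + 4δ)/U` for every `U ≥ (1156/δ)²`, hence
# for every `c < √2 − 1`, eventually in `U`, `c ≤ (U/4)·(E₀ − OPT_DQG)`: `liminf_U ĉ_DQG(4; U) ≥ √2 − 1 ≈ 0.41421`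

HONEST FRAMING (verbatim): certified bounds for a stated model Hamiltonian in a stated basis; not a
claim about the real molecule beyond that model.

Seat rdm-B (gen 42; last file of the lift assembly). INPUTS: `…LiftFeasible.lean` (the exact lift family is
`(2,2)`-sector-DQG-feasible for `0 ≤ δ ≤ 1`, `0 ≤ η ≤ 1`, `1156·η ≤ δ`), gen 39's ring energy formula
`RingEnergy.hubbardRingTV_re_rdmEnergy_eq` (`Re E = −2t·Σ bonds + U·Σ doublons`), the objective sums of the coefficients
`LiftL4.lift_objective_sums` (`…LiftCoeffRows` §4: `B_{10} = D_{20} = 8 + 4√2`, `D_{21} = 4`), the Literature bound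
`pqgSectorEnergy_le_rdmEnergy`, and — on the `E₀` side — the typer's `tendsto_mul_energy_hubbardRingTV_four`
(`U·E₀(hubbardRingTV 4 1 U; 2, 2) → −12`, `Rows/HubbardRingStrongCouplingLimit.lean`).

THE THEOREMS: **`lift_re_rdmEnergy`** — at `ε = 1/U` the family member's energy on `hubbardRingTV 4 1 U` is
`(−8 − 4√2 + 4δ)/U`; **`lift_pqgSectorEnergy_le`** — `OPT_DQG(hubbardRingTV 4 1 U; 2, 2) ≤ (−8 − 4√2 + 4δ)/U` for every
`0 < δ ≤ 1` and every rational `U ≥ (1156/δ)²` (`η = U^{−1/2}`); **`eventually_mul_pqgSectorEnergy_le`** —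
`U·OPT_DQG ≤ −8 − 4√2 + 4δ` eventually; **`eventually_le_scaled_gap`** — for every `c < √2 − 1`,
`∀ᶠ U in atTop (ℚ), c ≤ (U/4)·(Model.energy _ 2 2 − Model.pqgSectorEnergy _ 2 2)`; **`sqrt_two_sub_one_le_of_tendsto`**
— IF the scaled gap converges (as S-U, `Rows/ConjectureSU.lean`, asserts with `c_DQG(4) ∈ [0.39, 0.42]`), its limit is
`≥ √2 − 1`; **`sqrt_two_sub_one_le_of_conjectureSU_clause`** — the same read on S-U's own convergence clause (`L = 2n`,
`n = 2`): any candidate plateau function has `c 2 ≥ √2 − 1`, so S-U's bracket can only be met in `[√2 − 1, 0.42]`.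

READING. The LOWER half, at kernel grade, of the 'lim' leaf of STRUCTURE §2.2.14 (`c_DQG(4) = √2 − 1` at words grade):
at strong coupling the level-DQG relaxation of the half-filled Hubbard 4-ring misses AT LEAST `(√2 − 1)·J` of the
ground-state energy (`J = 4t²/U`). Nothing is claimed about an UPPER bound on the scaled gap, the existence of the limit,
or `L ≥ 6`; no clause of S-U is proved or refuted (`[0.39, 0.42]` meets `[√2 − 1, ∞)`). NOT a row of `CERTIFIED.md`, no
claim node; S-U UNTOUCHED. Finite-`U` kernel points of the same family already in the tree: `(U/4)·gap ≥ 0.41005` at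
`U = 10⁴` (`…L4U10000DQGGap.lean`); SDP points `0.392` at `U = 10²`, `0.177` at `U = 10`. 0 sorry, 0 def, standard axioms.
References (docstring-only): D. A. Mazziotti, Adv. Chem. Phys. 134 (2007) ch. 3 §II.B, §II.F; M. Nakata et al., J. Chem.
Phys. 128 (2008) 164113 §II.C.
-/

set_option linter.style.longLine false

namespace Summit.Ventures.CertifiedQuantumChemistry

namespace LiftL4

open Matrix Finset SqrtTwo DQGGap Filter Topology
open Literature.MathematicalPhysics.QuantumLattice Literature.MathematicalPhysics.QuantumChemistry
open Summit.Ventures.CertifiedQuantumChemistry.Hamiltonians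
open scoped ComplexOrder

/-! ## §1 The energy along the family and the bound on `OPT_DQG` -/

/-- Bond sum of the one-matrix family: `Σ_{p,σ} γ(pσ; (p+1)σ) = ε·(8 + 4√2)`. -/
theorem liftGamR_bond (ε δ : ℝ) :
    ∑ p : Fin 4, ∑ σ : Fin 2, liftGamR ε δ (orb p σ) (orb (finRotate 4 p) σ) = ε * (8 + 4 * Real.sqrt 2) := by
  simp only [liftGamR_orb]
  simp only [sum_family]
  simp only [lift_objective_sums.1]
  simp [Fin.sum_univ_three, Fin.sum_univ_two, toReal_zero]

/-- Doublon sum of the two-matrix family: `Σ_p Γ(p↑ p↓; p↑ p↓) = ε²·(8 + 4√2) + ε²δ·4`. -/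
theorem liftGGR_doublon (ε δ : ℝ) :
    ∑ p : Fin 4, liftGGR ε δ (orb p 0, orb p 1) (orb p 0, orb p 1) = ε ^ 2 * (8 + 4 * Real.sqrt 2) + ε ^ 2 * δ * 4 := by
  simp only [liftGGR_orb]
  simp only [sum_family]
  simp only [lift_objective_sums.2]
  simp [Fin.sum_univ_three, Fin.sum_univ_two, toReal_zero]

/-- **THE ENERGY OF THE FAMILY** for `hubbardRingTV 4 1 U` at `ε = 1/U` (`U ≠ 0`): `Re E = (−8 − 4√2 + 4δ)/U`
(gen 39's ring energy formula `Re E = −2t·Σ bonds + U·Σ doublons`; only Hermiticity and antisymmetry are used). -/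
theorem lift_re_rdmEnergy (U : ℚ) (hU : U ≠ 0) (δ : ℝ) :
    (rdmEnergy (fun p q => ((hubbardRingTV 4 1 U).h p q : ℂ)) (fun p q r s => ((hubbardRingTV 4 1 U).eri p q r s : ℂ))
        ((hubbardRingTV 4 1 U).ecore : ℂ) (liftGamC (1 / U) δ) (liftGGC (1 / U) δ)).re =
      (-8 - 4 * Real.sqrt 2 + 4 * δ) / U := by
  have hγ : ∀ x y, liftGamC (1 / U) δ x y = ((liftGamR (1 / U) δ x y : ℝ) : ℂ) := fun _ _ => rfl
  have hΓ : ∀ P R, liftGGC (1 / U) δ P R = ((liftGGR (1 / U) δ P R : ℝ) : ℂ) := fun _ _ => rfl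
  rw [RingEnergy.hubbardRingTV_re_rdmEnergy_eq (by norm_num) 1 U (liftGamC_isHermitian _ _) (liftGGC_swap_fst _ _)
    (liftGGC_swap_snd _ _)]
  simp only [hγ, hΓ, Complex.ofReal_re, liftGamR_bond, liftGGR_doublon]
  have hU' : (U : ℝ) ≠ 0 := by exact_mod_cast hU
  push_cast
  field_simp
  ring

/-- **`OPT_DQG ≤ (−8 − 4√2 + 4δ)/U` FOR EVERY `U ≥ (1156/δ)²`** (`0 < δ ≤ 1`): the programme's value on
`hubbardRingTV 4 1 U`, sector `(2,2)`, lies below the energy of the feasible family member at `ε = 1/U`. -/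
theorem lift_pqgSectorEnergy_le {δ : ℝ} (hδ0 : 0 < δ) (hδ1 : δ ≤ 1) {U : ℚ} (hU : (1156 : ℝ) ^ 2 / δ ^ 2 ≤ U) :
    Model.pqgSectorEnergy (hubbardRingTV 4 1 U) 2 2 ≤ (-8 - 4 * Real.sqrt 2 + 4 * δ) / U := by
  have hδ2 : 0 < δ ^ 2 := by positivity
  have hU1 : (1 : ℝ) ≤ U := by
    refine le_trans ?_ hU
    rw [le_div_iff₀ hδ2]
    nlinarith
  have hU0 : (0 : ℝ) < U := by linarith
  have hUq : U ≠ 0 := by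
    rintro rfl
    simp at hU0
  set η : ℝ := (Real.sqrt U)⁻¹ with hη
  have hsq : 0 < Real.sqrt U := Real.sqrt_pos.2 hU0
  have hη0 : 0 ≤ η := by positivity
  have hη2 : η ^ 2 = 1 / U := by
    rw [hη, inv_pow, Real.sq_sqrt hU0.le, one_div]
  have hη1 : η ≤ 1 := by
    rw [hη, inv_le_one_iff₀]
    right
    rw [show (1 : ℝ) = Real.sqrt 1 by simp]
    exact Real.sqrt_le_sqrt hU1
  have hηδ : 1156 * η ≤ δ := by
    -- `1156 ≤ δ·√U` from `1156² ≤ δ²·U`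
    have h1 : (1156 : ℝ) ^ 2 ≤ δ ^ 2 * U := by
      rw [div_le_iff₀ hδ2] at hU
      linarith
    have h2 : (1156 : ℝ) ≤ δ * Real.sqrt U := by
      have h3 : Real.sqrt ((1156 : ℝ) ^ 2) ≤ Real.sqrt (δ ^ 2 * U) := Real.sqrt_le_sqrt h1
      rw [Real.sqrt_sq (by norm_num), Real.sqrt_mul (by positivity), Real.sqrt_sq hδ0.le] at h3
      exact h3
    rw [hη]
    rw [← div_eq_mul_inv, div_le_iff₀ hsq]
    exact h2
  have hf := lift_isDQGFeasibleSector hδ0.le hδ1 hη0 hη1 hηδ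
  rw [hη2] at hf
  have h := pqgSectorEnergy_le_rdmEnergy (fun p q => ((hubbardRingTV 4 1 U).h p q : ℂ))
    (fun p q r s => ((hubbardRingTV 4 1 U).eri p q r s : ℂ)) ((hubbardRingTV 4 1 U).ecore : ℂ) hf
  rw [lift_re_rdmEnergy U hUq δ] at h
  exact h

/-! ## §2 The kernel-grade plateau floor: `liminf_U (U/4)·(E₀ − OPT_DQG) ≥ √2 − 1` on the 4-ring -/

/-- **`U·OPT_DQG ≤ −8 − 4√2 + 4δ` EVENTUALLY**, for every `0 < δ ≤ 1`. -/
theorem eventually_mul_pqgSectorEnergy_le {δ : ℝ} (hδ0 : 0 < δ) (hδ1 : δ ≤ 1) :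
    ∀ᶠ U : ℚ in atTop, (U : ℝ) * Model.pqgSectorEnergy (hubbardRingTV 4 1 U) 2 2 ≤ -8 - 4 * Real.sqrt 2 + 4 * δ := by
  obtain ⟨q, hq⟩ := exists_rat_gt ((1156 : ℝ) ^ 2 / δ ^ 2)
  filter_upwards [eventually_ge_atTop q] with U hU
  have hUr : (1156 : ℝ) ^ 2 / δ ^ 2 ≤ U := hq.le.trans (by exact_mod_cast hU)
  have hU0 : (0 : ℝ) < U := lt_of_lt_of_le (by positivity) hUr
  have h := lift_pqgSectorEnergy_le hδ0 hδ1 hUr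
  rwa [le_div_iff₀ hU0, mul_comm] at h

/-- **THE PLATEAU FLOOR.** For every `c < √2 − 1`, eventually (as `U → ∞` along `ℚ`)
`c ≤ (U/4)·(E₀(4; 1, U; 2, 2) − OPT_DQG(4; 1, U; 2, 2))`: S-U's 4-ring plateau constant is AT LEAST `√2 − 1` at kernel
grade (the `E₀` side is the typer's `U·E₀ → −12`, `Rows/HubbardRingStrongCouplingLimit.lean`). -/
theorem eventually_le_scaled_gap {c : ℝ} (hc : c < Real.sqrt 2 - 1) :
    ∀ᶠ U : ℚ in atTop, c ≤ (U : ℝ) / 4 *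
      (Model.energy (hubbardRingTV 4 1 U) 2 2 - Model.pqgSectorEnergy (hubbardRingTV 4 1 U) 2 2) := by
  set δ : ℝ := min 1 ((Real.sqrt 2 - 1 - c) / 2) with hδ
  have hδ0 : 0 < δ := lt_min one_pos (by linarith)
  have hδ1 : δ ≤ 1 := min_le_left _ _
  have hδc : δ ≤ (Real.sqrt 2 - 1 - c) / 2 := min_le_right _ _
  have hE : ∀ᶠ U : ℚ in atTop, -12 - 2 * δ < (U : ℝ) * (hubbardRingTV 4 1 U).energy 2 2 :=
    tendsto_mul_energy_hubbardRingTV_four.eventually (lt_mem_nhds (by linarith))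
  filter_upwards [hE, eventually_mul_pqgSectorEnergy_le hδ0 hδ1] with U h1 h2
  have : (U : ℝ) / 4 * (Model.energy (hubbardRingTV 4 1 U) 2 2 - Model.pqgSectorEnergy (hubbardRingTV 4 1 U) 2 2) =
      ((U : ℝ) * (hubbardRingTV 4 1 U).energy 2 2 - (U : ℝ) * Model.pqgSectorEnergy (hubbardRingTV 4 1 U) 2 2) / 4 := by
    ring
  rw [this]
  linarith

/-- **COROLLARY (the limit, if it exists, is at least `√2 − 1`).** If the scaled gap of the 4-ring converges along `ℚ`
(as S-U conjectures, `Rows/ConjectureSU.lean`), its limit is `≥ √2 − 1 ≈ 0.41421`. -/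
theorem sqrt_two_sub_one_le_of_tendsto {c₀ : ℝ} (h : Tendsto (fun U : ℚ => (U : ℝ) / 4 *
      (Model.energy (hubbardRingTV 4 1 U) 2 2 - Model.pqgSectorEnergy (hubbardRingTV 4 1 U) 2 2)) atTop (𝓝 c₀)) :
    Real.sqrt 2 - 1 ≤ c₀ :=
  le_of_forall_lt_imp_le_of_dense fun _ hc => ge_of_tendsto h (eventually_le_scaled_gap hc)

/-- **COROLLARY (S-U's shape).** For ANY candidate plateau function `c : ℕ → ℝ` satisfying the convergence clause of
conjecture S-U, level DQG (`Rows/ConjectureSU.lean`, `ConjectureSU_DQG`: for every `n ≥ 2` the scaled gap of the ring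
`L = 2n` tends to `c n`), the 4-ring constant obeys `√2 − 1 ≤ c 2` — so S-U's registered bracket `c 2 ∈ [0.39, 0.42]`
can only be met in `[√2 − 1, 0.42]`. (S-U itself is neither proved nor refuted here.) -/
theorem sqrt_two_sub_one_le_of_conjectureSU_clause {c : ℕ → ℝ}
    (h : ∀ n, 2 ≤ n → 0 ≤ c n ∧
      Tendsto (fun U : ℚ => ((U : ℝ) / 4) *
          (Model.energy (hubbardRingTV (2*n) 1 U) n n - Model.pqgSectorEnergy (hubbardRingTV (2*n) 1 U) n n))
        atTop (𝓝 (c n))) :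
    Real.sqrt 2 - 1 ≤ c 2 :=
  sqrt_two_sub_one_le_of_tendsto (h 2 le_rfl).2

/-! ## §3 Appended (rdm-B gen 42, same day): `limsup_U U·OPT_DQG ≤ −8 − 4√2` and eventual NON-EXACTNESS on the 4-ring -/

/-- **`limsup_U U·OPT_DQG(hubbardRingTV 4 1 U; 2, 2) ≤ −8 − 4√2 ≈ −13.657`** in the `∀ᶠ` form: for every `b > −8 − 4√2`,
eventually (in `U` along `ℚ`) `U·OPT_DQG ≤ b` (STRUCTURE §2.2.14's phrasing of the lift's consequence; `δ := min 1 ((b + 8 + 4√2)/4)`). -/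
theorem eventually_mul_pqgSectorEnergy_le_of_lt {b : ℝ} (hb : -8 - 4 * Real.sqrt 2 < b) :
    ∀ᶠ U : ℚ in atTop, (U : ℝ) * Model.pqgSectorEnergy (hubbardRingTV 4 1 U) 2 2 ≤ b := by
  set δ : ℝ := min 1 ((b + 8 + 4 * Real.sqrt 2) / 4) with hδ
  have hδ0 : 0 < δ := lt_min one_pos (by linarith)
  have hδ1 : δ ≤ 1 := min_le_left _ _
  have hδb : δ ≤ (b + 8 + 4 * Real.sqrt 2) / 4 := min_le_right _ _
  filter_upwards [eventually_mul_pqgSectorEnergy_le hδ0 hδ1] with U hU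
  linarith

/-- **COROLLARY (eventual non-exactness).** The level-DQG relaxation is NOT exact on the half-filled Hubbard 4-ring at
every sufficiently large `U` (along `ℚ`): `∀ᶠ U, OPT_DQG(hubbardRingTV 4 1 U; 2, 2) < E₀(hubbardRingTV 4 1 U; 2, 2)` — the
plateau floor with `c = 1/5 < √2 − 1`. (Kernel points already in the tree: `U = 1, 10, 10², 10⁴` and the rational
`U`-intervals of `…L4U100DQGGap.lean` §3; this is the first statement covering a whole neighbourhood of `U = ∞`.) -/
theorem eventually_dqg_not_exact :
    ∀ᶠ U : ℚ in atTop, Model.pqgSectorEnergy (hubbardRingTV 4 1 U) 2 2 < Model.energy (hubbardRingTV 4 1 U) 2 2 := by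
  have hc : (1 : ℝ) / 5 < Real.sqrt 2 - 1 := by
    have h : (6 : ℝ) / 5 < Real.sqrt 2 := by
      rw [show (6 : ℝ) / 5 = Real.sqrt ((6 / 5) ^ 2) by rw [Real.sqrt_sq (by norm_num)]]
      exact Real.sqrt_lt_sqrt (by norm_num) (by norm_num)
    linarith
  filter_upwards [eventually_le_scaled_gap hc, eventually_gt_atTop (0 : ℚ)] with U h1 h2
  have hU : (0 : ℝ) < U := by exact_mod_cast h2
  have h3 : 0 < (U : ℝ) / 4 *
      (Model.energy (hubbardRingTV 4 1 U) 2 2 - Model.pqgSectorEnergy (hubbardRingTV 4 1 U) 2 2) :=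
    lt_of_lt_of_le (by norm_num) h1
  rcases mul_pos_iff.mp h3 with ⟨_, h⟩ | ⟨h, _⟩
  · linarith
  · linarith

end LiftL4

end Summit.Ventures.CertifiedQuantumChemistry
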